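import Mathlib
import Literature.Computability.AlgebraicComplexity.MatrixMultiplicationExponent
import HarnessLib

/-!
# Polystability of the matrix multiplication tensor (Bürgisser–Ikenmeyer 2017, Cor. 4.9)

A NAMED FACT (D-0014, statement only), requested by route MatrixMultiplication/ToricBorderRank
(support item `HilbertMumfordHalf`, stmt-MatrixMultiplication-9968, whose (⇒) direction starts
from "`⟨n,n,n⟩` is polystable, so its orbit is the closed orbit in `cl(SL³·T)`"). It grounds
`Summit.MatrixMultiplication.MatrixMultiplication.Theses.ToricBorderRank.HilbertMumfordHalf`
as ONE INGREDIENT (the other two — the Hilbert–Mumford criterion in the Luna/Kempf form and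
de Groote's isotropy theorem — are not vendored here).

* `BurgisserIkenmeyer2017_cor49_matMulTensor` — P. Bürgisser, C. Ikenmeyer, *Fundamental
  invariants of orbit closures*, J. Algebra 477 (2017) 390–434 (= arXiv:1511.02927, held text,
  §4.2), **Corollary 4.9** (numbering of the arXiv version; attributed there to Meyer 2006):
  "The unit tensors `⟨m⟩` and the matrix multiplication tensors `⟨n,n,n⟩` are polystable."
  with the printed definition (§4.2, first sentence): "We call a tensor `w ∈ ⊗³ℂ^m` *polystable*
  iff the `SL_m^3`-orbit of `w` is closed."  Only the matrix-multiplication half is vendored.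

## Rendering
* `⟨n,n,n⟩ ∈ ℂ^m ⊗ ℂ^m ⊗ ℂ^m`, `m = n²`, is the tree's `matMulTensor ℂ n n n`
  (`(Fin n × Fin n) → (Fin n × Fin n) → (Fin n × Fin n) → ℂ`, Bläser's coordinates; BI's
  `∑ e_{ij} ⊗ e_{jk} ⊗ e_{ki}` differs by a permutation of basis vectors in each factor, i.e. by a
  `GL³`-translation `h`, and `SL³·(h·w) = h·(SL³·w)` is closed iff `SL³·w` is, `h` acting by a
  homeomorphism and normalising `SL³`).
* `SL_m^3` = `Matrix.SpecialLinearGroup (Fin n × Fin n) ℂ` cubed, acting factorwise by the explicit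
  triple sum `(g·t)(a,b,c) = ∑_{a',b',c'} A_{aa'} B_{bb'} C_{cc'} t(a',b',c')` — the same spelling as
  the requesting item (no `actTensor`, to keep the import closure small).
* "orbit closed": the source works in the Zariski topology of the affine space `⊗³ℂ^m`; for an
  orbit of a connected complex linear algebraic group the Zariski closure equals the Euclidean
  closure (orbits are constructible and open in their closure), so `IsClosed` in the product
  (Euclidean) topology of `(… → ℂ)` renders the same property, and it is the topology in which
  the requesting item states `closure (Set.range …)`.

## References
* [BurgisserIkenmeyer2017] P. Bürgisser, C. Ikenmeyer, Fundamental invariants of orbit closures,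
  J. Algebra 477 (2017) 390–434; arXiv:1511.02927: §4.2, Prop. 4.8 (polystability criterion for
  tensors, via the Hilbert–Mumford criterion as refined by Luna 1975 and Kempf 1978) and Cor. 4.9.
* K. Meyer, Polystabilität des Matrixmultiplikationstensors (Diplomarbeit, Paderborn 2006), as
  cited there.
-/

noncomputable section

open scoped BigOperators

namespace Literature.Computability.AlgebraicComplexity

/-- **Bürgisser–Ikenmeyer 2017, Cor. 4.9 (matrix-multiplication half): `⟨n,n,n⟩` is polystable**
— the orbit of `matMulTensor ℂ n n n` under `SL_{n²}(ℂ)³`, acting factorwise on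
`ℂ^{n×n} ⊗ ℂ^{n×n} ⊗ ℂ^{n×n}`, is closed. Grounds (as an ingredient, see the module docstring)
`Summit.MatrixMultiplication.MatrixMultiplication.Theses.ToricBorderRank.HilbertMumfordHalf`.
[cite: BurgisserIkenmeyer2017, Cor. 4.9 with §4.2 (definition of polystable)] -/
def BurgisserIkenmeyer2017_cor49_matMulTensor : Prop :=
  ∀ n : ℕ, IsClosed (Set.range fun g : Matrix.SpecialLinearGroup (Fin n × Fin n) ℂ ×
      Matrix.SpecialLinearGroup (Fin n × Fin n) ℂ × Matrix.SpecialLinearGroup (Fin n × Fin n) ℂ =>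
    (fun a b c => ∑ a', ∑ b', ∑ c', (g.1 : Matrix (Fin n × Fin n) (Fin n × Fin n) ℂ) a a' *
      (g.2.1 : Matrix (Fin n × Fin n) (Fin n × Fin n) ℂ) b b' *
      (g.2.2 : Matrix (Fin n × Fin n) (Fin n × Fin n) ℂ) c c' * matMulTensor ℂ n n n a' b' c'))

end Literature.Computability.AlgebraicComplexity
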